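import Mathlib
import Summits.Ventures.PercRepro2.ReimerDecreasing

/-!
# A union form of Reimer's inequality for nested pairs (blind cell PercRepro2, mine-1)

`reimer_union_decr` (`MINE-1.md` Theorem 16.7, "union Reimer"): for increasing events `E₁ ⊆ E₂` and
`F₂ ⊆ F₁` on the cube `U` and a decreasing event `D`,

  `#{S ⊆ U : (E₁ □ F₁ or E₂ □ F₂ at S) ∧ S ∈ D}`
      `≤ #{S ⊆ U : ((S ∈ E₁ ∧ U \ S ∈ F₁) ∨ (S ∈ E₂ ∧ U \ S ∈ F₂)) ∧ S ∈ D}`.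

With one pair (`E₁ = E₂`, `F₁ = F₂`) this is `reimer_decreasing`; with `D = ⊤` it is the plain union
form `reimer_union`.  It is strictly stronger than Reimer for the outer pair `(E₂, F₁)`: the right-hand
side is the UNION of the two small targets `E₁ ∩ F̄₁`, `E₂ ∩ F̄₂`, not the big target `E₂ ∩ F̄₁`.  The
proof is the Bollobás–Leader induction once more: the level-0 set `Z = E₁₀ □ F₁₀ ∪ E₂₀ □ F₂₀` lies in
both level-1 sets `X = E₁₀ □ F₁₁ ∪ E₂₀ □ F₂₁` and `Y = E₁₁ □ F₁₀ ∪ E₂₁ □ F₂₀`, the sections of the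
right-hand side are the union targets of the nested chains `(E₁₀, F₁₁) ⊆ (E₂₀, F₂₁)` and
`(E₁₁, F₁₀) ⊆ (E₂₁, F₂₀)`, and the decreasing restriction is carried along as in `reimer_decreasing`.
(The same proof gives chains of any length.)

Relevance: the two pieces of Conjecture AC (the R13 crux) are `(A ∩ C) □ B` and `A □ (B ∩ C)` inside
`{blue ∈ C}` — a nested chain with `D = C̄`; `reimer_union_decr` bounds their union by
`#{A ∩ B̄ ∩ C̄}`, and AC asks for the smaller target `#{A ∩ B̄ ∩ C ∩ C̄}`.
-/

namespace Summit.Ventures.PercRepro2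

namespace ReimerCube

variable {E : Type*} [DecidableEq E]

open Classical in
/-- **Union Reimer with a decreasing restriction (MINE-1 Theorem 16.7).**  For increasing `E₁ ⊆ E₂`,
`F₂ ⊆ F₁`, a decreasing `D` and a ground set `U`:
`#{S ⊆ U : (E₁ □ F₁ ∨ E₂ □ F₂) ∧ D} ≤ #{S ⊆ U : ((E₁ S ∧ F₁ (U \ S)) ∨ (E₂ S ∧ F₂ (U \ S))) ∧ D S}`. -/
theorem reimer_union_decr (U : Finset E) :
    ∀ (E₁ E₂ F₁ F₂ D : Finset E → Prop), Incr E₁ → Incr E₂ → Incr F₁ → Incr F₂ → Decr D →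
      (∀ S, E₁ S → E₂ S) → (∀ S, F₂ S → F₁ S) →
      (U.powerset.filter (fun S => (DOcc E₁ F₁ S ∨ DOcc E₂ F₂ S) ∧ D S)).card
        ≤ (U.powerset.filter
            (fun S => ((E₁ S ∧ F₁ (U \ S)) ∨ (E₂ S ∧ F₂ (U \ S))) ∧ D S)).card := by
  induction U using Finset.induction_on with
  | empty =>
    intro E₁ E₂ F₁ F₂ D _ _ _ _ _ _ _
    apply Finset.card_le_card
    intro S hS
    rw [Finset.mem_filter, Finset.mem_powerset] at hS ⊢
    obtain ⟨hS0, hD, hDS⟩ := hS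
    have hS0' : S = ∅ := Finset.subset_empty.mp hS0
    refine ⟨hS0, ?_, hDS⟩
    rcases hD with ⟨K, L, hK, hL, -, hAK, hBL⟩ | ⟨K, L, hK, hL, -, hAK, hBL⟩
    · rw [hS0'] at hL
      exact Or.inl ⟨hAK S hK, hBL _ (hL.trans (Finset.empty_subset _))⟩
    · rw [hS0'] at hL
      exact Or.inr ⟨hAK S hK, hBL _ (hL.trans (Finset.empty_subset _))⟩
  | insert i U hi ih =>
    intro E₁ E₂ F₁ F₂ D hE₁ hE₂ hF₁ hF₂ hD h12 h21
    have hD10 : ∀ S, sec1 i D S → D S := fun S h => sec1_le_decr hD i S h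
    rw [card_filter_powerset_insert hi, card_filter_powerset_insert hi]
    have e1 : U.powerset.filter
          (fun S => (DOcc E₁ F₁ (insert i S) ∨ DOcc E₂ F₂ (insert i S)) ∧ D (insert i S))
        = U.powerset.filter (fun S => ((DOcc E₁ (sec1 i F₁) S ∨ DOcc E₂ (sec1 i F₂) S) ∨ (DOcc (sec1 i E₁) F₁ S ∨ DOcc (sec1 i E₂) F₂ S)) ∧ sec1 i D S) := by
      apply Finset.filter_congr
      intro S hS
      have hiS : i ∉ S := fun h => hi (Finset.mem_powerset.mp hS h)
      rw [dOcc_insert_iff hF₁ hiS, dOcc_insert_iff hF₂ hiS]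
      constructor
      · rintro ⟨h, hd⟩
        exact ⟨by tauto, hd⟩
      · rintro ⟨h, hd⟩
        exact ⟨by tauto, hd⟩
    have e2 : U.powerset.filter
          (fun S => ((E₁ S ∧ F₁ (insert i U \ S)) ∨ (E₂ S ∧ F₂ (insert i U \ S))) ∧ D S)
        = U.powerset.filter
            (fun S => ((E₁ S ∧ sec1 i F₁ (U \ S)) ∨ (E₂ S ∧ sec1 i F₂ (U \ S))) ∧ D S) := by
      apply Finset.filter_congr
      intro S hS
      rw [insert_sdiff_of_not_mem' (Finset.mem_powerset.mp hS) hi]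
      rfl
    have e3 : U.powerset.filter (fun S =>
          ((E₁ (insert i S) ∧ F₁ (insert i U \ insert i S))
            ∨ (E₂ (insert i S) ∧ F₂ (insert i U \ insert i S))) ∧ D (insert i S))
        = U.powerset.filter
            (fun S => ((sec1 i E₁ S ∧ F₁ (U \ S)) ∨ (sec1 i E₂ S ∧ F₂ (U \ S))) ∧ sec1 i D S) := by
      apply Finset.filter_congr
      intro S _
      rw [insert_sdiff_insert' hi]
      rfl
    rw [e1, e2, e3]
    -- Z ⊆ X and Z ⊆ Y
    have hZX : ∀ S, (DOcc E₁ F₁ S ∨ DOcc E₂ F₂ S) → (DOcc E₁ (sec1 i F₁) S ∨ DOcc E₂ (sec1 i F₂) S) := by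
      intro S h
      rcases h with h | h
      · exact Or.inl (h.mono_right (incr_le_sec1 hF₁ i))
      · exact Or.inr (h.mono_right (incr_le_sec1 hF₂ i))
    have hZY : ∀ S, (DOcc E₁ F₁ S ∨ DOcc E₂ F₂ S) → (DOcc (sec1 i E₁) F₁ S ∨ DOcc (sec1 i E₂) F₂ S) := by
      intro S h
      rcases h with h | h
      · exact Or.inl (h.mono_left (incr_le_sec1 hE₁ i))
      · exact Or.inr (h.mono_left (incr_le_sec1 hE₂ i))
    -- inclusion–exclusion at level 1 inside D₁
    have hU : U.powerset.filter (fun S => ((DOcc E₁ (sec1 i F₁) S ∨ DOcc E₂ (sec1 i F₂) S) ∨ (DOcc (sec1 i E₁) F₁ S ∨ DOcc (sec1 i E₂) F₂ S)) ∧ sec1 i D S)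
        = U.powerset.filter (fun S => (DOcc E₁ (sec1 i F₁) S ∨ DOcc E₂ (sec1 i F₂) S) ∧ sec1 i D S)
          ∪ U.powerset.filter (fun S => (DOcc (sec1 i E₁) F₁ S ∨ DOcc (sec1 i E₂) F₂ S) ∧ sec1 i D S) := by
      ext S
      simp only [Finset.mem_filter, Finset.mem_union]
      tauto
    have hI : U.powerset.filter (fun S => ((DOcc E₁ (sec1 i F₁) S ∨ DOcc E₂ (sec1 i F₂) S) ∧ (DOcc (sec1 i E₁) F₁ S ∨ DOcc (sec1 i E₂) F₂ S)) ∧ sec1 i D S)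
        = U.powerset.filter (fun S => (DOcc E₁ (sec1 i F₁) S ∨ DOcc E₂ (sec1 i F₂) S) ∧ sec1 i D S)
          ∩ U.powerset.filter (fun S => (DOcc (sec1 i E₁) F₁ S ∨ DOcc (sec1 i E₂) F₂ S) ∧ sec1 i D S) := by
      ext S
      simp only [Finset.mem_filter, Finset.mem_inter]
      tauto
    have h_or := Finset.card_union_add_card_inter
      (U.powerset.filter (fun S => (DOcc E₁ (sec1 i F₁) S ∨ DOcc E₂ (sec1 i F₂) S) ∧ sec1 i D S))
      (U.powerset.filter (fun S => (DOcc (sec1 i E₁) F₁ S ∨ DOcc (sec1 i E₂) F₂ S) ∧ sec1 i D S))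
    rw [← hU, ← hI] at h_or
    have h_sub : (U.powerset.filter (fun S => (DOcc E₁ F₁ S ∨ DOcc E₂ F₂ S) ∧ sec1 i D S)).card
        ≤ (U.powerset.filter (fun S => ((DOcc E₁ (sec1 i F₁) S ∨ DOcc E₂ (sec1 i F₂) S) ∧ (DOcc (sec1 i E₁) F₁ S ∨ DOcc (sec1 i E₂) F₂ S)) ∧ sec1 i D S)).card := by
      apply Finset.card_le_card
      intro S hS
      rw [Finset.mem_filter] at hS ⊢
      exact ⟨hS.1, ⟨hZX S hS.2.1, hZY S hS.2.1⟩, hS.2.2⟩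
    -- split the level-0 counts along D₁ ⊆ D₀
    have hs1 : (U.powerset.filter (fun S => (DOcc E₁ F₁ S ∨ DOcc E₂ F₂ S) ∧ D S)).card
        = (U.powerset.filter (fun S => (DOcc E₁ F₁ S ∨ DOcc E₂ F₂ S) ∧ sec1 i D S)).card
          + (U.powerset.filter (fun S => (DOcc E₁ F₁ S ∨ DOcc E₂ F₂ S) ∧ D S ∧ ¬ sec1 i D S)).card := by
      have h := Finset.card_filter_add_card_filter_not
        (s := U.powerset.filter (fun S => (DOcc E₁ F₁ S ∨ DOcc E₂ F₂ S) ∧ D S)) (fun S => sec1 i D S)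
      rw [Finset.filter_filter, Finset.filter_filter] at h
      have f1 : U.powerset.filter (fun S => ((DOcc E₁ F₁ S ∨ DOcc E₂ F₂ S) ∧ D S) ∧ sec1 i D S)
          = U.powerset.filter (fun S => (DOcc E₁ F₁ S ∨ DOcc E₂ F₂ S) ∧ sec1 i D S) := by
        apply Finset.filter_congr
        intro S _
        constructor
        · rintro ⟨⟨h1, -⟩, h3⟩
          exact ⟨h1, h3⟩
        · rintro ⟨h1, h3⟩
          exact ⟨⟨h1, hD10 S h3⟩, h3⟩
      have f2 : U.powerset.filter (fun S => ((DOcc E₁ F₁ S ∨ DOcc E₂ F₂ S) ∧ D S) ∧ ¬ sec1 i D S)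
          = U.powerset.filter (fun S => (DOcc E₁ F₁ S ∨ DOcc E₂ F₂ S) ∧ D S ∧ ¬ sec1 i D S) := by
        apply Finset.filter_congr
        intro S _
        tauto
      rw [f1, f2] at h
      omega
    have hs2 : (U.powerset.filter (fun S => (DOcc E₁ (sec1 i F₁) S ∨ DOcc E₂ (sec1 i F₂) S) ∧ D S)).card
        = (U.powerset.filter (fun S => (DOcc E₁ (sec1 i F₁) S ∨ DOcc E₂ (sec1 i F₂) S) ∧ sec1 i D S)).card
          + (U.powerset.filter (fun S => (DOcc E₁ (sec1 i F₁) S ∨ DOcc E₂ (sec1 i F₂) S) ∧ D S ∧ ¬ sec1 i D S)).card := by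
      have h := Finset.card_filter_add_card_filter_not
        (s := U.powerset.filter (fun S => (DOcc E₁ (sec1 i F₁) S ∨ DOcc E₂ (sec1 i F₂) S) ∧ D S)) (fun S => sec1 i D S)
      rw [Finset.filter_filter, Finset.filter_filter] at h
      have f1 : U.powerset.filter (fun S => ((DOcc E₁ (sec1 i F₁) S ∨ DOcc E₂ (sec1 i F₂) S) ∧ D S) ∧ sec1 i D S)
          = U.powerset.filter (fun S => (DOcc E₁ (sec1 i F₁) S ∨ DOcc E₂ (sec1 i F₂) S) ∧ sec1 i D S) := by
        apply Finset.filter_congr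
        intro S _
        constructor
        · rintro ⟨⟨h1, -⟩, h3⟩
          exact ⟨h1, h3⟩
        · rintro ⟨h1, h3⟩
          exact ⟨⟨h1, hD10 S h3⟩, h3⟩
      have f2 : U.powerset.filter (fun S => ((DOcc E₁ (sec1 i F₁) S ∨ DOcc E₂ (sec1 i F₂) S) ∧ D S) ∧ ¬ sec1 i D S)
          = U.powerset.filter (fun S => (DOcc E₁ (sec1 i F₁) S ∨ DOcc E₂ (sec1 i F₂) S) ∧ D S ∧ ¬ sec1 i D S) := by
        apply Finset.filter_congr
        intro S _
        tauto
      rw [f1, f2] at h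
      omega
    have h_sub2 : (U.powerset.filter (fun S => (DOcc E₁ F₁ S ∨ DOcc E₂ F₂ S) ∧ D S ∧ ¬ sec1 i D S)).card
        ≤ (U.powerset.filter (fun S => (DOcc E₁ (sec1 i F₁) S ∨ DOcc E₂ (sec1 i F₂) S) ∧ D S ∧ ¬ sec1 i D S)).card := by
      apply Finset.card_le_card
      intro S hS
      rw [Finset.mem_filter] at hS ⊢
      exact ⟨hS.1, hZX S hS.2.1, hS.2.2⟩
    have ih1 := ih E₁ E₂ (sec1 i F₁) (sec1 i F₂) D hE₁ hE₂ (incr_sec1 hF₁ i) (incr_sec1 hF₂ i) hD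
      h12 (fun S h => h21 _ h)
    have ih2 := ih (sec1 i E₁) (sec1 i E₂) F₁ F₂ (sec1 i D) (incr_sec1 hE₁ i) (incr_sec1 hE₂ i)
      hF₁ hF₂ (decr_sec1 hD i) (fun S h => h12 _ h) h21
    omega

open Classical in
/-- **Union Reimer (no restriction).**  For increasing `E₁ ⊆ E₂` and `F₂ ⊆ F₁`:
`#{S ⊆ U : E₁ □ F₁ ∨ E₂ □ F₂} ≤ #{S ⊆ U : (E₁ S ∧ F₁ (U \ S)) ∨ (E₂ S ∧ F₂ (U \ S))}`. -/
theorem reimer_union (U : Finset E) (E₁ E₂ F₁ F₂ : Finset E → Prop)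
    (hE₁ : Incr E₁) (hE₂ : Incr E₂) (hF₁ : Incr F₁) (hF₂ : Incr F₂)
    (h12 : ∀ S, E₁ S → E₂ S) (h21 : ∀ S, F₂ S → F₁ S) :
    (U.powerset.filter (fun S => DOcc E₁ F₁ S ∨ DOcc E₂ F₂ S)).card
      ≤ (U.powerset.filter (fun S => (E₁ S ∧ F₁ (U \ S)) ∨ (E₂ S ∧ F₂ (U \ S)))).card := by
  have h := reimer_union_decr U E₁ E₂ F₁ F₂ (fun _ => True) hE₁ hE₂ hF₁ hF₂
    (fun _ _ _ _ => trivial) h12 h21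
  simpa using h

end ReimerCube

end Summit.Ventures.PercRepro2
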